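import Literature.NumberTheory.LFunctions.Zhang2022.DetectorTwoSidedCompose
import Literature.NumberTheory.LFunctions.Zhang2022.DetectorTwoSidedCircle
import Literature.NumberTheory.LFunctions.Zhang2022.DetectorTwoPointIdentity
import Literature.NumberTheory.LFunctions.Zhang2022.RepairDetGlued

/-!
# [K6″, node-free] The two-sided doubling route composed on ALL glued sides `Det.GluedSides`:
# `Det.FormDetGlued b ⪰ 0` and the slot `Det.GluedFormPSD b` for EVERY sign-admissible triple ([K2″] discharged)

Y. Zhang, *Discrete mean estimates and the Landau–Siegel zero*, arXiv:2211.02515v1 [Zhang2022LandauSiegel] —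
an unrefereed manuscript under adjudication. **WHAT THIS IS NOT: not a claim about Theorems 1–2 of
arXiv:2211.02515, about Landau–Siegel zeros, about a repaired `Margin232`, or about Parity; nothing here asserts
E-102, the E-010 slot, or the (A)-world meaning of the glued form. The programme SEARCHES and TYPES; no claim
about Landau–Siegel zeros, Theorems 1–2 of arXiv:2211.02515 or a repaired Margin232 until a kernel theorem says so.**

CONTEXT (cell landau-siegel §E, rows S-E-p5-13 / S-E-p6-3; slot of record `Det.GluedFormPSD b` of `RepairDetGlued`,
ls-barrier-p6 g3 p492465). `DetectorTwoSidedCompose` composes with the reflected side differentiable off a finite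
node set (to feed [K3′]'s pointwise right-derivatives); THIS file removes the node set: the reflected arc's second
transform rule comes from the IBP IDENTITY `reflArc_ibp` (change of variables `y ↦ 1 − y` in `Det.dpiece_deriv` for
the UNREFLECTED profile), fed to `Det.bulkFormOn_periodic_two_piece_nonneg_of_ibp` (`DetectorTwoSidedCircle`).

* Part 1: `dpiece_conj_reflect`, `dpiece_add'`, `dpiece_neg'`, **`reflArc_ibp`**, `reflArc_of_kinked₀`.
* Part 2 [K6″ node-free, interface form]: **`formDetGlued_nonneg_of_twoPointArc`** (explicit two-point piece `E`),
  **`formDetGlued_nonneg_of_twoPointArcs`** (`hK2 : ∀ p₁ q₁ p₂ q₂, ∃ E E′ E″, …` — the ∃-shape [K2″]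
  `Det.twoPoint_pieces` of `DetectorTwoPointIdentity` (ls-barrier-num g3) delivers, glue block in the tree's
  `F0DetC (shiftGlueW b) (shiftGlue0 b)` vocabulary), and **`gluedSides_formDetGlued_nonneg_of_twoPointArcs`**:
  `SignAdmissible b → hK2 → ∀ u u′ v v′, GluedSides u u′ v v′ → 0 ≤ FormDetGlued b u u′ v v′` — i.e. `GluedFormPSD b`
  modulo [K2″], for bare kinked sides (no node set, no left-derivatives).

* Part 3 [discharge]: `twoPointGlue_eq_F0DetC` (dictionary atoms ↔ `F0DetC`), **`formDetGlued_nonneg_of_signAdmissible`**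
  (unconditional, all bare kinked no-overlap sides) and **`gluedFormPSD_of_signAdmissible : SignAdmissible b →
  Det.GluedFormPSD b`** — the glued slot of `RepairDetGlued` is a theorem for every sign-admissible triple
  ([K1″] + [K2″] `Det.twoPoint_pieces` p492723 + [K3′]/`reflArc_ibp` + [K5]).

0 named facts, 0 `def`s, 0 sorries; standard axioms. Cell landau-siegel, ls-barrier-p5 g4. References: Y. Zhang,
arXiv:2211.02515v1 (2022), Prop. 7.1 p.44, (8.11)–(8.23), §12 (12.6)–(12.8), §18 (18.1); barrier/num/TWO-SIDED-CIRCLE.md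
§5 (ls-barrier-num, cell-internal). [cite: Zhang2022LandauSiegel, Prop 7.1 p.44 with (7.2), (8.11)–(8.23)]
-/

noncomputable section

open Complex Real Set intervalIntegral Filter Topology
open _root_.MeasureTheory
open scoped ComplexConjugate

namespace Literature.NumberTheory.LFunctions.Zhang2022

namespace Det

open Repair

variable {b : Fin 3 → ℝ}

/-! ### Part 1 — the conjugate-reflected arc satisfies the per-piece IBP identity -/

section Reflect

variable {g g' : ℝ → ℂ}

/-- `∫ₐᵇ conj f = conj ∫ₐᵇ f` for interval integrals. [folklore] -/
private theorem intervalIntegral_conj_refl (f : ℝ → ℂ) (a c : ℝ) :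
    ∫ x in a..c, conj (f x) = conj (∫ x in a..c, f x) := by
  simp only [intervalIntegral, integral_conj, map_sub]

/-- **Transform of a conjugate reflection**: `D[conj f(1−·)](m) = k_m(1)·conj D[f](m)` on `[0,1]`
(`k_m(1−u) = k_m(1)·conj k_m(u)`). [cite: Zhang2022LandauSiegel, Prop 7.1 p.44 with (8.11)–(8.23); §12 (12.6)–(12.8)] -/
theorem dpiece_conj_reflect (f : ℝ → ℂ) (m : ℤ) :
    dpiece 0 1 (fun y => conj (f (1 - y))) m = cexp (-(I * π * m * ((1:ℝ) : ℂ))) * conj (dpiece 0 1 f m) := by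
  unfold dpiece
  have step : (∫ y in (0:ℝ)..1, (fun y => conj (f (1 - y))) y * cexp (-(I * π * m * (y : ℂ))))
      = ∫ y in (0:ℝ)..1, (fun u : ℝ => conj (f u) * cexp (-(I * π * m * (((1 - u : ℝ)) : ℂ)))) (1 - y) := by
    refine intervalIntegral.integral_congr fun y _ => ?_
    simp only [sub_sub_cancel]
  rw [step, intervalIntegral.integral_comp_sub_left
    (fun u : ℝ => conj (f u) * cexp (-(I * π * m * (((1 - u : ℝ)) : ℂ)))) 1]
  simp only [sub_self, sub_zero]
  rw [← intervalIntegral_conj_refl, ← intervalIntegral.integral_const_mul]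
  refine intervalIntegral.integral_congr fun y _ => ?_
  simp only [map_mul, ← Complex.exp_conj, map_neg, Complex.conj_I, Complex.conj_ofReal, map_intCast]
  rw [mul_left_comm, ← Complex.exp_add]
  congr 2
  push_cast
  ring

/-- The transform is additive in the function (integrable data). [cite: Zhang2022LandauSiegel, Prop 7.1 p.44 with (7.2), (8.11)–(8.23)] -/
theorem dpiece_add' {a c : ℝ} {f h : ℝ → ℂ} (hf : IntervalIntegrable f volume a c)
    (hh : IntervalIntegrable h volume a c) (m : ℤ) :
    dpiece a c (fun y => f y + h y) m = dpiece a c f m + dpiece a c h m := by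
  have kcont : Continuous fun y : ℝ => cexp (-(I * π * m * y)) := by fun_prop
  unfold dpiece
  rw [← intervalIntegral.integral_add (hf.mul_continuousOn kcont.continuousOn) (hh.mul_continuousOn kcont.continuousOn)]
  refine intervalIntegral.integral_congr fun y _ => ?_
  ring

/-- The transform is compatible with negation. [cite: Zhang2022LandauSiegel, Prop 7.1 p.44 with (7.2), (8.11)–(8.23)] -/
theorem dpiece_neg' {a c : ℝ} (f : ℝ → ℂ) (m : ℤ) : dpiece a c (fun y => -f y) m = -dpiece a c f m := by
  unfold dpiece
  rw [← intervalIntegral.integral_neg]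
  exact intervalIntegral.integral_congr fun y _ => by ring

/-- **The reflected arc's IBP identity.** For a one-sided kinked profile `g` (continuous, RIGHT-derivative `g′` on
`(0,1)`, `g′ ∈ L²`), the conjugate-reflected first-derivative arc `G′ = conj(−g(1−·))` and its companion
`G″ = −conj(−g′(1−·))` satisfy `∫₀¹ G″k_m = G′(1)k_m(1) − G′(0)k_m(0) + iπm·∫₀¹ G′k_m` — obtained from
`Det.dpiece_deriv` for `(g, g′)` itself by the change of variables `y ↦ 1 − y` and `|k_m(1)| = 1`; no left-derivative
of `g` is used. [cite: Zhang2022LandauSiegel, Prop 7.1 p.44 with (8.11)–(8.23); §12 (12.6)–(12.8)] -/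
theorem reflArc_ibp (hg : KinkedProfile g g') (m : ℤ) :
    dpiece 0 1 (fun y => -conj (-g' (1 - y))) m
      = (fun y : ℝ => conj (-g (1 - y))) 1 * cexp (-(I * π * m * ((1:ℝ) : ℂ)))
        - (fun y : ℝ => conj (-g (1 - y))) 0 * cexp (-(I * π * m * ((0:ℝ) : ℂ)))
        + I * π * m * dpiece 0 1 (fun y => conj (-g (1 - y))) m := by
  have ibp := dpiece_deriv zero_le_one hg.cont hg.hasDeriv (intervalIntegrable_of_memLp_Ioc zero_le_one hg.memLp) m
  have e1 : (fun y => -conj (-g' (1 - y))) = fun y => conj (g' (1 - y)) := by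
    funext y; simp only [map_neg, neg_neg]
  have e2 : (fun y => conj (-g (1 - y))) = fun y => conj ((fun u => -g u) (1 - y)) := rfl
  rw [e1, dpiece_conj_reflect g' m, e2, dpiece_conj_reflect (fun u => -g u) m, dpiece_neg', ibp]
  simp only [sub_self, sub_zero, map_neg, map_sub, map_add, map_mul, Complex.conj_I, Complex.conj_ofReal,
    map_intCast, ← Complex.exp_conj]
  push_cast
  simp only [mul_one, mul_zero, neg_zero, Complex.exp_zero]
  have hk : cexp (-(I * π * m)) * cexp (-(-I * π * m)) = 1 := by
    rw [← Complex.exp_add, ← Complex.exp_zero]; congr 1; ring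
  linear_combination (conj (g 1)) * hk

/-- **The conjugate-reflected arc of a one-sided kinked profile** (node-free form): `G = −conj S(1−·)`,
`S = tailPrim g`, has `G, G′` continuous on `[0,1]`, right-derivative `G → G′` on `(0,1)`, and `G″ ∈ L²`
(`G′ = conj(−g(1−·))`, `G″ = −conj(−g′(1−·))`). [cite: Zhang2022LandauSiegel, Prop 7.1 p.44 with (8.11)–(8.23); §12 (12.6)–(12.8)] -/
theorem reflArc_of_kinked₀ (hg : KinkedProfile g g') (hg1 : g 1 = 0) :
    ContinuousOn (fun y => -conj (tailPrim g (1 - y))) (Icc (0:ℝ) 1)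
    ∧ ContinuousOn (fun y => conj (-g (1 - y))) (Icc (0:ℝ) 1)
    ∧ (∀ y ∈ Ioo (0:ℝ) 1,
        HasDerivWithinAt (fun y => -conj (tailPrim g (1 - y))) (conj (-g (1 - y))) (Ioi y) y)
    ∧ MemLp (fun y => -conj (-g' (1 - y))) 2 (volume.restrict (Ioc (0:ℝ) 1)) := by
  obtain ⟨hTc, -, -, -, -, -, -⟩ := rightPiece_of_kinked hg hg1
  have hmaps : MapsTo (fun y : ℝ => 1 - y) (Icc (0:ℝ) 1) (Icc (0:ℝ) 1) := fun y hy =>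
    ⟨by linarith [hy.2], by linarith [hy.1]⟩
  have hsub : ContinuousOn (fun y : ℝ => 1 - y) (Icc (0:ℝ) 1) := (continuous_const.sub continuous_id).continuousOn
  have c1 : ContinuousOn (fun y => tailPrim g (1 - y)) (Icc (0:ℝ) 1) := hTc.comp hsub hmaps
  have c2 : ContinuousOn (fun y => g (1 - y)) (Icc (0:ℝ) 1) := hg.cont.comp hsub hmaps
  refine ⟨(Complex.continuous_conj.comp_continuousOn c1).neg, Complex.continuous_conj.comp_continuousOn c2.neg,
    ?_, ?_⟩
  · intro y hy
    have hx : 1 - y ∈ Ioo (0:ℝ) 1 := ⟨by linarith [hy.2], by linarith [hy.1]⟩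
    have hT := hasDerivAt_tailPrim hg.cont hx
    have h1m : HasDerivAt (fun y : ℝ => 1 - y) (-1) y := by simpa using (hasDerivAt_id y).const_sub 1
    have hc := ((hT.scomp y h1m).star).neg
    refine (hc.congr_deriv ?_).hasDerivWithinAt
    simp only [neg_smul, one_smul, neg_neg]
    rfl
  · -- `L²` transport along the measure-preserving reflection of `(0,1]`
    have hmp : MeasurePreserving (fun y : ℝ => 1 - y) (volume.restrict (Ioc (0:ℝ) 1))
        (volume.restrict (Ioc (0:ℝ) 1)) := by
      have h := (Measure.measurePreserving_sub_left (volume : Measure ℝ) (1:ℝ)).restrict_preimage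
        (measurableSet_Ioc (a := (0:ℝ)) (b := 1))
      have hpre : (fun y : ℝ => 1 - y) ⁻¹' Ioc (0:ℝ) 1 = Ico 0 1 := by
        ext y
        simp only [mem_preimage, mem_Ioc, mem_Ico]
        constructor <;> rintro ⟨h1, h2⟩ <;> constructor <;> linarith
      rw [hpre, restrict_Ico_eq_restrict_Ioc] at h
      exact h
    have h1 : MemLp (g' ∘ fun y : ℝ => 1 - y) 2 (volume.restrict (Ioc (0:ℝ) 1)) :=
      hg.memLp.comp_measurePreserving hmp
    have h2 : MemLp (fun y => conj (g' (1 - y))) 2 (volume.restrict (Ioc (0:ℝ) 1)) :=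
      (Complex.conjCLE.toContinuousLinearMap).comp_memLp' h1
    have : (fun y => -conj (-g' (1 - y))) = fun y => conj (g' (1 - y)) := by
      funext y; simp only [map_neg, neg_neg]
    rw [this]; exact h2

end Reflect

/-! ### Part 2 — [K6″, node-free] the composition on all glued sides, given [K2″] -/

section Compose

variable {g₁ g₁' g₂ g₂' : ℝ → ℂ}

/-- Continuity transported along `y ↦ y + 1` (as in [K6]). [folklore] -/
private theorem continuousOn_translate_one' {F : ℝ → ℂ} (hF : ContinuousOn F (Icc 0 1)) :
    ContinuousOn (fun y => F (y + 1)) (Icc (-1) 0) := by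
  refine hF.comp (continuous_id.add continuous_const).continuousOn fun y hy => ?_
  exact ⟨by linarith [hy.1], by linarith [hy.2]⟩

/-- Right-derivatives transported along `y ↦ y + 1` (as in [K6]). [folklore] -/
private theorem hasDerivWithinAt_translate_one' {F F' : ℝ → ℂ}
    (hF : ∀ y ∈ Ioo (0:ℝ) 1, HasDerivWithinAt F (F' y) (Ioi y) y) {y : ℝ} (hy : y ∈ Ioo (-1:ℝ) 0) :
    HasDerivWithinAt (fun y => F (y + 1)) (F' (y + 1)) (Ioi y) y := by
  have hy' : y + 1 ∈ Ioo (0:ℝ) 1 := ⟨by linarith [hy.1], by linarith [hy.2]⟩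
  have h := hF (y + 1) hy'
  have h2 : HasDerivWithinAt (fun t : ℝ => t + 1) (1:ℝ) (Ioi y) y := (hasDerivAt_id y).add_const 1 |>.hasDerivWithinAt
  have := h.scomp y h2 (fun t ht => by simpa using ht)
  rw [Function.comp_def] at this
  simpa using this

/-- **[K6″, node-free] interface form (the two-point piece displayed).** Let `b` be sign-admissible; `g₁, g₂` bare
one-sided kinked profiles on `[0,1]` (continuous, RIGHT-derivatives, `L²` companions) SUPPORTED in `[0,t₁]`,
`[0,t₂]` with no overlap after reflection, `0 ≤ t_i`, `t₁ + t₂ ≤ 1`. If `E` is a piece on `[0,1]` (continuous with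
right-derivatives `E′, E″`) with the two-point jets `(E,E′)(0) = (−conj ∫₀¹g₂, −conj g₂(0))`,
`(E,E′)(1) = (∫₀¹g₁, −g₁(0))` and the [K2″] identity
`c₀·T_b^{[0,1]}(E) = F_b(∫g₁,−g₁0) + F_b(∫g₂,−g₂0) + π·Re F₀(g₁0,∫g₁; g₂0,∫g₂)`, then `0 ≤ FormDetGlued b g₁ g₁′ g₂ g₂′`
(circle function `E(·+1) ⊕ (S₁ − conj S₂(1−·))`; the reflected arc's second rule by `reflArc_ibp`).
[cite: Zhang2022LandauSiegel, Prop 7.1 p.44 with (7.2), (8.11)–(8.23); §8 (8.2); §12 (12.6)–(12.8); §18 (18.1)] -/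
theorem formDetGlued_nonneg_of_twoPointArc (hb : SignAdmissible b)
    (hg₁ : KinkedProfile g₁ g₁') (hg₂ : KinkedProfile g₂ g₂') {t₁ t₂ : ℝ} (ht₁ : 0 ≤ t₁) (ht₂ : 0 ≤ t₂)
    (ht : t₁ + t₂ ≤ 1)
    (hz₁ : ∀ y ∈ Icc t₁ 1, g₁ y = 0 ∧ g₁' y = 0) (hz₂ : ∀ y ∈ Icc t₂ 1, g₂ y = 0 ∧ g₂' y = 0)
    {E E' E'' : ℝ → ℂ} (hc : ContinuousOn E (Icc 0 1)) (hc' : ContinuousOn E' (Icc 0 1))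
    (hc'' : ContinuousOn E'' (Icc 0 1))
    (hd : ∀ y ∈ Ioo (0:ℝ) 1, HasDerivWithinAt E (E' y) (Ioi y) y)
    (hd' : ∀ y ∈ Ioo (0:ℝ) 1, HasDerivWithinAt E' (E'' y) (Ioi y) y)
    (hE0 : E 0 = -conj (∫ y in (0:ℝ)..1, g₂ y)) (hE0' : E' 0 = -conj (g₂ 0))
    (hE1 : E 1 = ∫ y in (0:ℝ)..1, g₁ y) (hE1' : E' 1 = -g₁ 0)
    (hid : (∑ j : Fin 3, shiftW b j).re * bulkFormOn b 0 1 E E' E''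
      = freeEndForm b (∫ y in (0:ℝ)..1, g₁ y) (-g₁ 0) + freeEndForm b (∫ y in (0:ℝ)..1, g₂ y) (-g₂ 0)
        + π * (F0DetC (shiftGlueW b) (shiftGlue0 b) b (g₁ 0) (∫ y in (0:ℝ)..1, g₁ y) (g₂ 0)
            (∫ y in (0:ℝ)..1, g₂ y)).re) :
    0 ≤ FormDetGlued b g₁ g₁' g₂ g₂' := by
  have ht₁1 : t₁ ≤ 1 := by linarith
  have ht₂1 : t₂ ≤ 1 := by linarith
  have h1₁ : g₁ 1 = 0 := (hz₁ 1 ⟨ht₁1, le_rfl⟩).1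
  have h1₂ : g₂ 1 = 0 := (hz₂ 1 ⟨ht₂1, le_rfl⟩).1
  -- side 1 arc `S₁ = tailPrim g₁`
  obtain ⟨hS₁c, hS₁'c, hS₁d, hS₁'d, hS₁''m, -, -⟩ := rightPiece_of_kinked hg₁ h1₁
  -- reflected side 2 arc `G = −conj (tailPrim g₂ (1−·))` (node-free data + IBP identity)
  obtain ⟨hGc, hG'c, hGd, hG''m⟩ := reflArc_of_kinked₀ hg₂ h1₂
  -- separated supports
  have hzS : ∀ y ∈ Icc (0:ℝ) 1, t₁ ≤ y →
      tailPrim g₁ y = 0 ∧ (fun y => -g₁ y) y = 0 ∧ (fun y => -g₁' y) y = 0 := by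
    intro y hy hty
    obtain ⟨e0, e1⟩ := hz₁ y ⟨hty, hy.2⟩
    exact ⟨tailPrim_eq_zero_of_support (fun z hz => (hz₁ z hz).1) hy hty, by simp [e0], by simp [e1]⟩
  have hzG : ∀ y ∈ Icc (0:ℝ) 1, y ≤ t₁ →
      (fun y => -conj (tailPrim g₂ (1 - y))) y = 0 ∧ (fun y => conj (-g₂ (1 - y))) y = 0
        ∧ (fun y => -conj (-g₂' (1 - y))) y = 0 := by
    intro y hy hty
    have hx : 1 - y ∈ Icc (0:ℝ) 1 := ⟨by linarith [hy.2], by linarith [hy.1]⟩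
    have htx : t₂ ≤ 1 - y := by linarith
    obtain ⟨e0, e1⟩ := hz₂ (1 - y) ⟨htx, hx.2⟩
    refine ⟨?_, by simp [e0], by simp [e1]⟩
    simp only [tailPrim_eq_zero_of_support (fun z hz => (hz₂ z hz).1) hx htx, map_zero, neg_zero]
  have hA := bulkFormOn_add_of_separated b t₁ hzS hzG hS₁c hS₁'c hS₁''m hGc hG'c hG''m
  have hrefl := bulkFormOn_reflect_conj b (tailPrim g₂) (fun y => -g₂ y) (fun y => -g₂' y)
  -- the IBP identity of the superposed right arc `R′ = −g₁ + G′`, `R″ = −g₁′ + G″`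
  have i₁' : IntervalIntegrable (fun y => -g₁ y) volume 0 1 := hS₁'c.intervalIntegrable_of_Icc zero_le_one
  have i₁'' : IntervalIntegrable (fun y => -g₁' y) volume 0 1 := intervalIntegrable_of_memLp_Ioc zero_le_one hS₁''m
  have iG' : IntervalIntegrable (fun y => conj (-g₂ (1 - y))) volume 0 1 := hG'c.intervalIntegrable_of_Icc zero_le_one
  have iG'' : IntervalIntegrable (fun y => -conj (-g₂' (1 - y))) volume 0 1 :=
    intervalIntegrable_of_memLp_Ioc zero_le_one hG''m
  have hRibp : ∀ m : ℤ, dpiece 0 1 (fun y => -g₁' y + -conj (-g₂' (1 - y))) m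
      = (-g₁ 1 + conj (-g₂ (1 - 1))) * cexp (-(I * π * m * ((1:ℝ) : ℂ)))
        - (-g₁ 0 + conj (-g₂ (1 - 0))) * cexp (-(I * π * m * ((0:ℝ) : ℂ)))
        + I * π * m * dpiece 0 1 (fun y => -g₁ y + conj (-g₂ (1 - y))) m := by
    intro m
    have eA := dpiece_add' i₁'' iG'' m
    have eB := dpiece_add' i₁' iG' m
    have e1 := dpiece_deriv zero_le_one hS₁'c hS₁'d i₁'' m
    have e2 := reflArc_ibp hg₂ m
    simp only [] at e1 e2
    linear_combination eA + e1 + e2 - I * π * m * eB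
  -- the periodic two-piece inequality on the cell `[−1,1]`
  have hcell := bulkFormOn_periodic_two_piece_nonneg_of_ibp hb
    (L := fun y => E (y + 1)) (L' := fun y => E' (y + 1)) (L'' := fun y => E'' (y + 1))
    (R := fun y => tailPrim g₁ y + -conj (tailPrim g₂ (1 - y)))
    (R' := fun y => -g₁ y + conj (-g₂ (1 - y)))
    (R'' := fun y => -g₁' y + -conj (-g₂' (1 - y)))
    (continuousOn_translate_one' hc) (continuousOn_translate_one' hc')
    (memLp_two_of_continuousOn_Icc' (continuousOn_translate_one' hc''))
    (fun y hy => hasDerivWithinAt_translate_one' hd hy) (fun y hy => hasDerivWithinAt_translate_one' hd' hy)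
    (hS₁c.add hGc) (hS₁'c.add hG'c) (hS₁''m.add hG''m)
    (fun y hy => (hS₁d y hy).add (hGd y hy)) hRibp
    (by simp only [zero_add, hE1, sub_zero, tailPrim_one, tailPrim_zero, map_zero, neg_zero, add_zero])
    (by simp only [zero_add, hE1', sub_zero, h1₂, neg_zero, map_zero, add_zero])
    (by simp only [neg_add_cancel, hE0, sub_self, tailPrim_one, tailPrim_zero, zero_add])
    (by simp only [neg_add_cancel, hE0', sub_self, h1₁, neg_zero, map_neg, zero_add])
  rw [bulkFormOn_comp_add_one, hA, hrefl] at hcell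
  -- assemble with [K1″] and [K5]
  have hK1 := formDetGlued_eq_bulk_add hb.injective hg₁ h1₁ hg₂ h1₂
  rw [← hid] at hK1
  have hc0 : 0 < (∑ j : Fin 3, shiftW b j).re := re_sum_shiftW_pos hb
  have key : π / 2 * FormDetGlued b g₁ g₁' g₂ g₂'
      = (∑ j : Fin 3, shiftW b j).re * (bulkFormOn b 0 1 E E' E''
          + (bulkFormOn b 0 1 (tailPrim g₁) (fun y => -g₁ y) (fun y => -g₁' y)
            + bulkFormOn b 0 1 (tailPrim g₂) (fun y => -g₂ y) (fun y => -g₂' y))) := by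
    rw [hK1]; ring
  have hπ : 0 < π / 2 := by positivity
  exact (mul_nonneg_iff_of_pos_left hπ).1 (key ▸ mul_nonneg hc0.le hcell)

/-- **[K6″, node-free] with the two-point piece quantified over all jet data** — the interface [K2″]
(`Det.twoPoint_pieces`, `DetectorTwoPointIdentity`, ls-barrier-num g3; glue block written with the tree's
`F0DetC (shiftGlueW b) (shiftGlue0 b)`, dictionary `twoPointGlue_eq_F0DetC` in the discharge part) delivers.
[cite: Zhang2022LandauSiegel, Prop 7.1 p.44 with (7.2), (8.11)–(8.23); §8 (8.2); §18 (18.1)] -/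
theorem formDetGlued_nonneg_of_twoPointArcs (hb : SignAdmissible b)
    (hK2 : ∀ p₁ q₁ p₂ q₂ : ℂ, ∃ E E' E'' : ℝ → ℂ,
      ContinuousOn E (Icc 0 1) ∧ ContinuousOn E' (Icc 0 1) ∧ ContinuousOn E'' (Icc 0 1) ∧
      (∀ y ∈ Ioo (0:ℝ) 1, HasDerivWithinAt E (E' y) (Ioi y) y) ∧
      (∀ y ∈ Ioo (0:ℝ) 1, HasDerivWithinAt E' (E'' y) (Ioi y) y) ∧
      E 0 = -conj p₂ ∧ E' 0 = conj q₂ ∧ E 1 = p₁ ∧ E' 1 = q₁ ∧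
      (∑ j : Fin 3, shiftW b j).re * bulkFormOn b 0 1 E E' E''
        = freeEndForm b p₁ q₁ + freeEndForm b p₂ q₂
          + π * (F0DetC (shiftGlueW b) (shiftGlue0 b) b (-q₁) p₁ (-q₂) p₂).re)
    (hg₁ : KinkedProfile g₁ g₁') (hg₂ : KinkedProfile g₂ g₂') {t₁ t₂ : ℝ} (ht₁ : 0 ≤ t₁) (ht₂ : 0 ≤ t₂)
    (ht : t₁ + t₂ ≤ 1)
    (hz₁ : ∀ y ∈ Icc t₁ 1, g₁ y = 0 ∧ g₁' y = 0) (hz₂ : ∀ y ∈ Icc t₂ 1, g₂ y = 0 ∧ g₂' y = 0) :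
    0 ≤ FormDetGlued b g₁ g₁' g₂ g₂' := by
  obtain ⟨E, E', E'', hc, hc', hc'', hd, hd', h0, h0', h1, h1', hid⟩ :=
    hK2 (∫ y in (0:ℝ)..1, g₁ y) (-g₁ 0) (∫ y in (0:ℝ)..1, g₂ y) (-g₂ 0)
  rw [map_neg] at h0'
  rw [neg_neg, neg_neg] at hid
  exact formDetGlued_nonneg_of_twoPointArc hb hg₁ hg₂ ht₁ ht₂ ht hz₁ hz₂ hc hc' hc'' hd hd' h0 h0' h1 h1' hid

/-- **[K6″, node-free] on the tree's no-overlap class `Det.GluedSides`**: for a sign-admissible `b` and the two-point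
pieces [K2″], EVERY glued pair of bare kinked sides has `0 ≤ FormDetGlued b u u′ v v′` — the slot
`Det.GluedFormPSD b` of `RepairDetGlued` (ls-barrier-p6 g3) modulo [K2″], verbatim.
[cite: Zhang2022LandauSiegel, Prop 7.1 p.44 with (7.2), (8.11)–(8.23); §12 (12.6)–(12.8); §18 (18.1)] -/
theorem gluedSides_formDetGlued_nonneg_of_twoPointArcs {u u' v v' : ℝ → ℂ} (hb : SignAdmissible b)
    (hK2 : ∀ p₁ q₁ p₂ q₂ : ℂ, ∃ E E' E'' : ℝ → ℂ,
      ContinuousOn E (Icc 0 1) ∧ ContinuousOn E' (Icc 0 1) ∧ ContinuousOn E'' (Icc 0 1) ∧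
      (∀ y ∈ Ioo (0:ℝ) 1, HasDerivWithinAt E (E' y) (Ioi y) y) ∧
      (∀ y ∈ Ioo (0:ℝ) 1, HasDerivWithinAt E' (E'' y) (Ioi y) y) ∧
      E 0 = -conj p₂ ∧ E' 0 = conj q₂ ∧ E 1 = p₁ ∧ E' 1 = q₁ ∧
      (∑ j : Fin 3, shiftW b j).re * bulkFormOn b 0 1 E E' E''
        = freeEndForm b p₁ q₁ + freeEndForm b p₂ q₂
          + π * (F0DetC (shiftGlueW b) (shiftGlue0 b) b (-q₁) p₁ (-q₂) p₂).re)
    (h : GluedSides u u' v v') : 0 ≤ FormDetGlued b u u' v v' := by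
  obtain ⟨t₁, t₂, ht₁, ht₂, ht, hu, hv⟩ := h.sep
  exact formDetGlued_nonneg_of_twoPointArcs hb hK2 h.kinked₁ h.kinked₂ ht₁ ht₂ ht
    (fun y hy => hu y hy.1) (fun y hy => hv y hy.1)

end Compose

/-! ### Part 3 — [K2″] discharged (`DetectorTwoPointIdentity`, ls-barrier-num g3): the glued slot
`Det.GluedFormPSD b` for EVERY sign-admissible triple -/

section Discharge

variable {g₁ g₁' g₂ g₂' : ℝ → ℂ}

/-- **Dictionary** between the atom form of the glue block ([K2″]'s `Det.twoPointGlue`, no division by `b_j`) and the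
tree's formula-II block with the cell's glue pair: for `b_j ≠ 0`,
`twoPointGlue b p₁ q₁ p₂ q₂ = F0DetC (shiftGlueW b) (shiftGlue0 b) b (−q₁) p₁ (−q₂) p₂`
(`W′_j = W_jN_j/b_j = N_j·ω_j`, `Σ_j W′_jb_j = A_N`, `Σ_j W′_jb_j² = e₃A₀`, `c_g = −e^{iπΣb/2} = −u₀u₁u₂`).
[cite: Zhang2022LandauSiegel, Prop 14.1, Lemma 15.1, §18 (18.1)] -/
theorem twoPointGlue_eq_F0DetC (h0 : b 0 ≠ 0) (h1 : b 1 ≠ 0) (h2 : b 2 ≠ 0) (p₁ q₁ p₂ q₂ : ℂ) :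
    twoPointGlue b p₁ q₁ p₂ q₂ = F0DetC (shiftGlueW b) (shiftGlue0 b) b (-q₁) p₁ (-q₂) p₂ := by
  have c0 : (b 0 : ℂ) ≠ 0 := by exact_mod_cast h0
  have c1 : (b 1 : ℂ) ≠ 0 := by exact_mod_cast h1
  have c2 : (b 2 : ℂ) ≠ 0 := by exact_mod_cast h2
  have hW0 : shiftGlueW b 0 = (shiftN b 0 : ℂ) * shiftWoverB b 0 := by
    unfold shiftGlueW; rw [shiftW_eq_mul_shiftWoverB]; field_simp
  have hW1 : shiftGlueW b 1 = (shiftN b 1 : ℂ) * shiftWoverB b 1 := by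
    unfold shiftGlueW; rw [shiftW_eq_mul_shiftWoverB]; field_simp
  have hW2 : shiftGlueW b 2 = (shiftN b 2 : ℂ) * shiftWoverB b 2 := by
    unfold shiftGlueW; rw [shiftW_eq_mul_shiftWoverB]; field_simp
  have hU : shiftGlue0 b = -(halfUnit b 0 * halfUnit b 1 * halfUnit b 2) := by
    unfold shiftGlue0 halfUnit
    rw [← Complex.exp_add, ← Complex.exp_add, Fin.sum_univ_three]
    congr 2
    push_cast
    ring
  unfold twoPointGlue F0DetC eDet atomG atomAN atomA0
  simp only [Fin.sum_univ_three, hW0, hW1, hW2, hU, shiftW_eq_mul_shiftWoverB]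
  simp only [shiftN, Matrix.cons_val_zero, Matrix.cons_val_one, Matrix.cons_val_two, Matrix.tail_cons,
    Matrix.head_cons]
  push_cast
  linear_combination (I * (π : ℂ) ^ 2 * p₂ * p₁ * (b 0 : ℂ) * (b 1 : ℂ) * (b 2 : ℂ)
    * ((b 0 : ℂ) * shiftWoverB b 0 + (b 1 : ℂ) * shiftWoverB b 1 + (b 2 : ℂ) * shiftWoverB b 2)) * Complex.I_sq

/-- **`FormDetGlued b ⪰ 0` on the no-overlap two-sided class, for EVERY sign-admissible triple `b` and ALL bare kinked
sides** — [K1″] + [K2″] (`Det.twoPoint_pieces`) + [K3′]/`reflArc_ibp` + [K5], unconditional: one-sided kinked `g₁`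
supported in `[0,t₁]`, `g₂` supported in `[0,t₂]`, `0 ≤ t_i`, `t₁ + t₂ ≤ 1`.
[cite: Zhang2022LandauSiegel, Prop 7.1 p.44 with (7.2), (8.11)–(8.23); §8 (8.2); §12 (12.6)–(12.8); §18 (18.1)] -/
theorem formDetGlued_nonneg_of_signAdmissible (hb : SignAdmissible b)
    (hg₁ : KinkedProfile g₁ g₁') (hg₂ : KinkedProfile g₂ g₂') {t₁ t₂ : ℝ} (ht₁ : 0 ≤ t₁) (ht₂ : 0 ≤ t₂)
    (ht : t₁ + t₂ ≤ 1)
    (hz₁ : ∀ y ∈ Icc t₁ 1, g₁ y = 0 ∧ g₁' y = 0) (hz₂ : ∀ y ∈ Icc t₂ 1, g₂ y = 0 ∧ g₂' y = 0) :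
    0 ≤ FormDetGlued b g₁ g₁' g₂ g₂' := by
  have h01 : b 0 ≠ b 1 := hb.injective.ne (by decide)
  have h02 : b 0 ≠ b 2 := hb.injective.ne (by decide)
  have h12 : b 1 ≠ b 2 := hb.injective.ne (by decide)
  have hc : (∑ j : Fin 3, shiftW b j).re ≠ 0 := (re_sum_shiftW_pos hb).ne'
  have hb0 : b 0 ≠ 0 := hb.1.ne'
  have hb1 : b 1 ≠ 0 := (hb.1.trans hb.2.1).ne'
  have hb2 : b 2 ≠ 0 := ((hb.1.trans hb.2.1).trans hb.2.2.1).ne'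
  refine formDetGlued_nonneg_of_twoPointArcs hb (fun p₁ q₁ p₂ q₂ => ?_) hg₁ hg₂ ht₁ ht₂ ht hz₁ hz₂
  obtain ⟨E, E', E'', hc₀, hc', hc'', hd, hd', e0, e0', e1, e1', hid⟩ := twoPoint_pieces b h01 h02 h12 hc p₁ q₁ p₂ q₂
  rw [twoPointGlue_eq_F0DetC hb0 hb1 hb2] at hid
  exact ⟨E, E', E'', hc₀, hc', hc'', hd, hd', e0, e0', e1, e1', hid⟩

/-- **The glued slot of the §E class book is a theorem for every sign-admissible triple:**
`SignAdmissible b → Det.GluedFormPSD b` (slot of `RepairDetGlued`, ls-barrier-p6 g3, verbatim: ALL glued sides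
`Det.GluedSides`, no node set, no left-derivatives). [cite: Zhang2022LandauSiegel, Prop 7.1 p.44 with (7.2), (8.11)–(8.23); §12 (12.6)–(12.8); §18 (18.1)] -/
theorem gluedFormPSD_of_signAdmissible (hb : SignAdmissible b) : GluedFormPSD b := by
  intro u u' v v' h
  obtain ⟨t₁, t₂, ht₁, ht₂, ht, hu, hv⟩ := h.sep
  exact formDetGlued_nonneg_of_signAdmissible hb h.kinked₁ h.kinked₂ ht₁ ht₂ ht
    (fun y hy => hu y hy.1) (fun y hy => hv y hy.1)

end Discharge

end Det

end Literature.NumberTheory.LFunctions.Zhang2022
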